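import Summits.KontsevichZagierPeriods.KontsevichZagierPeriods.Theorems.GpcLegendreLemniscatic.Negative.Canonical
import Literature.NumberTheory.Transcendental.KZSemialgebraicComplex
import Mathlib.MeasureTheory.Function.Jacobian

/-!
# `GpcLegendreLemniscatic` (stmt-KontsevichZagierPeriods-0280), line `hyperbola-fibration-conic`: stub `stub_conicPencil`

Move M2b of the line: ONE change-of-variables move (Kontsevich–Zagier rule (2), with exactly the
hypotheses of `KZ.changeOfVariablesRel`) along the conic rationalisation
`Ψ₂ z = update z 0 w(z)`, `w = √((z0⁴ − z1⁴)/(1 − z0⁴))`, from a triangle representation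
`T = [{0 < z1 < z0 < 1}, 2z0³/(√(1−z0⁴)√(z0⁴−z1⁴))]` to the half-strip representation
`p = [{0 < z0} ∩ {0 < z1 < 1}, 1/(1 + z0²)]`, GIVEN the pencil calculus (injectivity, image,
derivative with Jacobian `∂w/∂y`, pull-back identity) as a hypothesis (it is the neighbouring stub
`stub_pencilCalculus`). What is proved here:

* the triangle and the half-strip are `ℚ`-semialgebraic; `Ψ₂` is a `ℚ`-semialgebraic map on the
  triangle (its first coordinate is `√` of a quotient of `ℚ`-polynomials with non-vanishing
  denominator, the second is a coordinate);
* the half-strip representation `p` exists: its integrability is TRANSPORTED from `T` along `Ψ₂`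
  by `MeasureTheory.integrableOn_image_iff_integrableOn_abs_det_fderiv_smul` and the pull-back
  identity;
* `[T] − [p] ∈ changeOfVariablesRel`, hence `Equivalent T p`.

No definitions and no notation are introduced (all objects are written out). References: Kontsevich–Zagier 2001 §1.2
rule (2); Bochnak–Coste–Roy 1998 §2.2.
-/

noncomputable section

open MeasureTheory Set
open Literature.NumberTheory.Transcendental
open Literature.NumberTheory.Transcendental.KZ
open Literature.ModelTheory.ExponentialFields (IsSemialgebraic isSemialgebraic_setOf_eval_lt)
open Summit.KontsevichZagierPeriods.Grothendieck.GpcLegendreLemniscaticNegative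

namespace Summit.KontsevichZagierPeriods.Grothendieck.GpcLegendreLemniscaticLine

/-! ## Semialgebraicity -/

/-- Coordinate order cells `{z | z i < z j}` of `ℝ²` are `ℚ`-semialgebraic. [folklore] -/
theorem conic_isSemialgebraic_lt (i j : Fin 2) :
    IsSemialgebraic ℚ {z : Fin 2 → ℝ | z i < z j} := by
  simpa using isSemialgebraic_setOf_eval_lt (k := ℚ) (R := ℝ)
    (MvPolynomial.X i : MvPolynomial (Fin 2) ℚ) (MvPolynomial.X j)

/-- Half-spaces `{z | 0 < z i}` of `ℝ²` are `ℚ`-semialgebraic. [folklore] -/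
theorem conic_isSemialgebraic_pos (i : Fin 2) :
    IsSemialgebraic ℚ {z : Fin 2 → ℝ | 0 < z i} := by
  simpa using isSemialgebraic_setOf_eval_lt (k := ℚ) (R := ℝ)
    (0 : MvPolynomial (Fin 2) ℚ) (MvPolynomial.X i)

/-- Half-spaces `{z | z i < 1}` of `ℝ²` are `ℚ`-semialgebraic. [folklore] -/
theorem conic_isSemialgebraic_lt_one (i : Fin 2) :
    IsSemialgebraic ℚ {z : Fin 2 → ℝ | z i < 1} := by
  simpa using isSemialgebraic_setOf_eval_lt (k := ℚ) (R := ℝ)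
    (MvPolynomial.X i : MvPolynomial (Fin 2) ℚ) 1

/-- The triangle `{0 < z1 < z0 < 1}` is `ℚ`-semialgebraic. [folklore] -/
theorem conic_isSemialgebraic_tri : IsSemialgebraic ℚ {z : Fin 2 → ℝ | 0 < z 1 ∧ z 1 < z 0 ∧ z 0 < 1} :=
  (conic_isSemialgebraic_pos 1).inter ((conic_isSemialgebraic_lt 1 0).inter
    (conic_isSemialgebraic_lt_one 0))

/-- The half-strip `{0 < z0} ∩ {0 < z1 < 1}` is `ℚ`-semialgebraic. [folklore] -/
theorem conic_isSemialgebraic_hst : IsSemialgebraic ℚ {z : Fin 2 → ℝ | 0 < z 0 ∧ 0 < z 1 ∧ z 1 < 1} :=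
  (conic_isSemialgebraic_pos 0).inter ((conic_isSemialgebraic_pos 1).inter
    (conic_isSemialgebraic_lt_one 1))

/-- The triangle is Lebesgue measurable. [folklore] -/
theorem conic_measurableSet_tri : MeasurableSet {z : Fin 2 → ℝ | 0 < z 1 ∧ z 1 < z 0 ∧ z 0 < 1} :=
  IsSemialgebraic.measurableSet_holds conic_isSemialgebraic_tri

/-- On the triangle `1 − z0⁴ ≠ 0`. [folklore] -/
theorem conic_one_sub_pow_ne {z : Fin 2 → ℝ} (hz : z ∈ {z : Fin 2 → ℝ | 0 < z 1 ∧ z 1 < z 0 ∧ z 0 < 1}) : 1 - z 0 ^ 4 ≠ 0 :=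
  (sub_pos.mpr (pow_lt_one₀ (hz.1.trans hz.2.1).le hz.2.2 four_ne_zero)).ne'

/-- `(fun z : Fin 2 → ℝ => Function.update z 0 (Real.sqrt ((z 0 ^ 4 - z 1 ^ 4) / (1 - z 0 ^ 4))))` is a `ℚ`-semialgebraic map on the triangle: its first coordinate is the square root of
a quotient of `ℚ`-polynomials with non-vanishing denominator, its second is a coordinate.
[cite: BochnakCosteRoy1998, §2.2 (Prop. 2.2.6)] -/
theorem conic_isSemialgebraicMapOn : IsSemialgebraicMapOn ℚ {z : Fin 2 → ℝ | 0 < z 1 ∧ z 1 < z 0 ∧ z 0 < 1} (fun z : Fin 2 → ℝ => Function.update z 0 (Real.sqrt ((z 0 ^ 4 - z 1 ^ 4) / (1 - z 0 ^ 4)))) := by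
  refine IsSemialgebraicMapOn.of_forall conic_isSemialgebraic_tri fun j => ?_
  fin_cases j
  · have hq := isSemialgebraicFunOn_aeval_div_aeval conic_isSemialgebraic_tri
      (MvPolynomial.X 0 ^ 4 - MvPolynomial.X 1 ^ 4 : MvPolynomial (Fin 2) ℚ)
      (1 - MvPolynomial.X 0 ^ 4) fun z hz => by
        simpa using conic_one_sub_pow_ne hz
    refine (IsSemialgebraicFunOn.sqrt_holds hq).congr fun z _ => ?_
    simp
  · refine (isSemialgebraicFunOn_aeval conic_isSemialgebraic_tri (MvPolynomial.X 1)).congr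
      fun z _ => ?_
    simp

/-- The conic integrand `1/(1 + z0²)` is `ℚ`-semialgebraic on the half-strip. [folklore] -/
theorem conic_isSemialgebraicFunOn_c :
    IsSemialgebraicFunOn ℚ {z : Fin 2 → ℝ | 0 < z 0 ∧ 0 < z 1 ∧ z 1 < 1} (fun z : Fin 2 → ℝ => 1 / (1 + z 0 ^ 2)) := by
  have h := isSemialgebraicFunOn_aeval_div_aeval conic_isSemialgebraic_hst
    (1 : MvPolynomial (Fin 2) ℚ) (1 + MvPolynomial.X 0 ^ 2) (fun z _ => by
      simp only [map_add, map_one, map_pow, MvPolynomial.aeval_X]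
      positivity)
  exact h.congr fun z _ => by
    simp only [map_add, map_one, map_pow, MvPolynomial.aeval_X]

/-! ## The registered stub -/

/-- **Stub `stub_conicPencil`** of line `hyperbola-fibration-conic` (crux
stmt-KontsevichZagierPeriods-0280, `GpcLegendreLemniscatic`), move M2b: given the pencil calculus of
the conic rationalisation `(fun z : Fin 2 → ℝ => Function.update z 0 (Real.sqrt ((z 0 ^ 4 - z 1 ^ 4) / (1 - z 0 ^ 4)))) z = update z 0 √((z0⁴−z1⁴)/(1−z0⁴))` on the triangle
`{0 < z1 < z0 < 1}` (injectivity, image = half-strip, derivative with Jacobian, pull-back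
identity), `(fun z : Fin 2 → ℝ => Function.update z 0 (Real.sqrt ((z 0 ^ 4 - z 1 ^ 4) / (1 - z 0 ^ 4))))` is ONE rule-(2) move from any triangle representation with integrand
`2z0³/(√(1−z0⁴)√(z0⁴−z1⁴))` to the half-strip representation `[{0 < z0} ∩ {0 < z1 < 1}, 1/(1+z0²)]`
(integrability transported by the Jacobian formula). [cite: KontsevichZagier2001, §1.2 rule (2)] -/
theorem stub_conicPencil :
    (InjOn (fun z : Fin 2 → ℝ => Function.update z 0 (Real.sqrt ((z 0 ^ 4 - z 1 ^ 4) / (1 - z 0 ^ 4))))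
        {z : Fin 2 → ℝ | 0 < z 1 ∧ z 1 < z 0 ∧ z 0 < 1} ∧
      (fun z : Fin 2 → ℝ => Function.update z 0 (Real.sqrt ((z 0 ^ 4 - z 1 ^ 4) / (1 - z 0 ^ 4)))) ''
          {z : Fin 2 → ℝ | 0 < z 1 ∧ z 1 < z 0 ∧ z 0 < 1} = {z : Fin 2 → ℝ | 0 < z 0 ∧ 0 < z 1 ∧ z 1 < 1} ∧
      (∀ z ∈ {z : Fin 2 → ℝ | 0 < z 1 ∧ z 1 < z 0 ∧ z 0 < 1},
        ∃ L : (Fin 2 → ℝ) →L[ℝ] (Fin 2 → ℝ),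
          HasFDerivAt (fun z : Fin 2 → ℝ =>
              Function.update z 0 (Real.sqrt ((z 0 ^ 4 - z 1 ^ 4) / (1 - z 0 ^ 4)))) L z ∧
            L.det = 2 * z 0 ^ 3 * (1 - z 1 ^ 4) /
              (Real.sqrt ((z 0 ^ 4 - z 1 ^ 4) / (1 - z 0 ^ 4)) * (1 - z 0 ^ 4) ^ 2)) ∧
      (∀ z ∈ {z : Fin 2 → ℝ | 0 < z 1 ∧ z 1 < z 0 ∧ z 0 < 1},
        2 * z 0 ^ 3 / (Real.sqrt (1 - z 0 ^ 4) * Real.sqrt (z 0 ^ 4 - z 1 ^ 4)) =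
          1 / (1 + Real.sqrt ((z 0 ^ 4 - z 1 ^ 4) / (1 - z 0 ^ 4)) ^ 2) *
            |2 * z 0 ^ 3 * (1 - z 1 ^ 4) /
              (Real.sqrt ((z 0 ^ 4 - z 1 ^ 4) / (1 - z 0 ^ 4)) * (1 - z 0 ^ 4) ^ 2)|)) →
    ∀ T : IntegralRep 2, T.domain = {z : Fin 2 → ℝ | 0 < z 1 ∧ z 1 < z 0 ∧ z 0 < 1} →
      EqOn T.integrand (fun z => 2 * z 0 ^ 3 / (Real.sqrt (1 - z 0 ^ 4) * Real.sqrt (z 0 ^ 4 - z 1 ^ 4)))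
          {z : Fin 2 → ℝ | 0 < z 1 ∧ z 1 < z 0 ∧ z 0 < 1} →
      ∃ p : IntegralRep 2, p.domain = {z : Fin 2 → ℝ | 0 < z 0 ∧ 0 < z 1 ∧ z 1 < 1} ∧
        EqOn p.integrand (fun z => 1 / (1 + z 0 ^ 2)) {z : Fin 2 → ℝ | 0 < z 0 ∧ 0 < z 1 ∧ z 1 < 1} ∧
        Equivalent T p := by
  intro H T hTd hTi
  obtain ⟨H1, H2, H3, H4⟩ := H
  -- (1) a derivative field on the triangle
  choose! Φ' hΦ' using H3
  -- (2) the pointwise identity `T.integrand = (c ∘ (fun z : Fin 2 → ℝ => Function.update z 0 (Real.sqrt ((z 0 ^ 4 - z 1 ^ 4) / (1 - z 0 ^ 4))))) · |det Φ'|` on the triangle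
  have hpt : ∀ z ∈ {z : Fin 2 → ℝ | 0 < z 1 ∧ z 1 < z 0 ∧ z 0 < 1}, T.integrand z = 1 / (1 + ((fun z : Fin 2 → ℝ => Function.update z 0 (Real.sqrt ((z 0 ^ 4 - z 1 ^ 4) / (1 - z 0 ^ 4)))) z) 0 ^ 2) * |(Φ' z).det| := by
    intro z hz
    rw [hTi hz, (hΦ' z hz).2]
    simp only [Function.update_self]
    exact H4 z hz
  -- (3) integrability of the conic integrand on the half-strip, transported from `T`
  have hint : IntegrableOn (fun z : Fin 2 → ℝ => 1 / (1 + z 0 ^ 2)) {z : Fin 2 → ℝ | 0 < z 0 ∧ 0 < z 1 ∧ z 1 < 1} volume := by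
    rw [← H2]
    refine (integrableOn_image_iff_integrableOn_abs_det_fderiv_smul volume conic_measurableSet_tri
      (fun z hz => (hΦ' z hz).1.hasFDerivWithinAt) H1 _).mpr ?_
    have hT : IntegrableOn T.integrand {z : Fin 2 → ℝ | 0 < z 1 ∧ z 1 < z 0 ∧ z 0 < 1} volume := hTd ▸ T.integrableOn
    refine hT.congr_fun (fun z hz => ?_) conic_measurableSet_tri
    rw [hpt z hz, smul_eq_mul, mul_comm]
  -- (4) the half-strip representation and the move
  let p : IntegralRep 2 :=
    { domain := {z : Fin 2 → ℝ | 0 < z 0 ∧ 0 < z 1 ∧ z 1 < 1}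
      integrand := fun z => 1 / (1 + z 0 ^ 2)
      isSemialgebraic_domain := conic_isSemialgebraic_hst
      isSemialgebraicFunOn_integrand := conic_isSemialgebraicFunOn_c
      integrableOn := hint }
  have hmem : of T - of p ∈ changeOfVariablesRel := by
    refine ⟨2, T, p, (fun z : Fin 2 → ℝ => Function.update z 0 (Real.sqrt ((z 0 ^ 4 - z 1 ^ 4) / (1 - z 0 ^ 4)))), Φ', ?_, fun z hz => ?_, ?_, ?_, fun z hz => ?_, rfl⟩
    · rw [hTd]; exact conic_isSemialgebraicMapOn
    · rw [hTd] at hz ⊢; exact (hΦ' z hz).1.hasFDerivWithinAt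
    · rw [hTd]; exact H1
    · rw [hTd]; exact H2.symm
    · rw [hTd] at hz
      exact hpt z hz
  exact ⟨p, rfl, fun _ _ => rfl, changeOfVariablesRel_subset_relations hmem⟩

end Summit.KontsevichZagierPeriods.Grothendieck.GpcLegendreLemniscaticLine
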